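/-
Width seat `ym-line-cbag-p1-w3` (prover-ym-line-cbag-p1-w3-g8-0), the only seat on LINE 3 `route-QuantumFields-SixPlaneColdBox`, crux
`TorusMeanNearColdBoxG` (stmt-QuantumFields-25708): the FREE HALF of its infrared stub — the torus plaquette mean is never much BELOW the
cold-box centre mean ("the cold box is colder"), unconditionally, every compact simple `G`.
-/
import Summits.QuantumFields.YangMills.Theorems.SixPlaneColdBoxGoodDatumSixPlaneForm
import Summits.QuantumFields.YangMills.Theorems.SixPlaneColdBoxTransferTorusSide
import Summits.QuantumFields.YangMills.Theorems.SixPlaneColdBoxTransferBudget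
import Summits.QuantumFields.YangMills.Theorems.ColdBoxAllGroupsBulkAllGroupsStubLargeFieldRarityG

/-!
# Route `SixPlaneColdBox`, crux `TorusMeanNearColdBoxG`: the torus mean is at least the cold-box mean, up to `3β^{−5/4}`

Crux `TorusMeanNearColdBoxG` (stmt-QuantumFields-25708) asks for the UPPER bound `E_torus[c_q] − E_{box ⌈β^θ⌉}[c_q(centre)] ≤ β^{−(1+4A+m)}`
(the infrared input of LINE 3).  The opposite inequality is free and is recorded here:

* `torusMean_sub_boxMean_ge` — for every compact simple `G`, lattice representation `r` and `0 < θ ≤ 1/200`: for all large `β`, then all large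
  odd tori `2S+1`, and every plane `q`, `−3β^{−5/4} ≤ E_torus[plaqCost0 q ∘ torusLift] − E_{boxState ⌈β^θ⌉}[c_{(centre; q)}]`.

Proof: DLR reads the torus mean through the box kernel (`torusMean_eq_kernelMean_pairG`); on crude-good boundary data the sharp one-scale mean
expansion with datum gives `β·E_ω[c] − β·E_1[c] ≥ −2β^{−1/4}` (the datum term `β Σ_c F̄_c²` is nonnegative: first clause of
`sixPlane_goodDatum_hlow`); bad data are `6(2H+3)⁴e^{−β^{θ/5}}`-rare on the torus (`measureReal_badSetG_le`, `stub_largeFieldRarityG`) and cost at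
most `4N`.  So the crux is genuinely ONE-sided: only `E_torus|F̄_ω|² = O(β^{−1−4A−m})` is missing.

No sorry; no definition; standard axioms.  NOT the Yang–Mills mass gap (RECORD-type node `LatticeNonFreezing`); no item is closed here.
-/

set_option autoImplicit false

noncomputable section

open MeasureTheory ProbabilityTheory Finset Real Filter Topology Metric
open scoped ENNReal
open Literature.Probability.LatticeModels (Site glueWith)
open Literature.MathematicalPhysics.QuantumLattice
open Literature.MathematicalPhysics.QuantumFieldTheory
open Literature.MathematicalPhysics.QuantumFieldTheory.LatticeMaxwell
open Literature.MathematicalPhysics.QuantumFieldTheory.AxialGauge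
open Summit.QuantumFields.YangMills.Theorems.WeakCouplingRates
open Summit.QuantumFields.YangMills.Theorems.FreeEnergyLogCoefficient
open Summit.QuantumFields.YangMills.Theorems.ColdBoxAllGroups

namespace Summit.QuantumFields.YangMills.Theorems.SixPlaneColdBox

set_option maxHeartbeats 800000 in
/-- **The torus plaquette mean is at least the cold-box centre mean, up to `3β^{−5/4}`** (the free half of crux `TorusMeanNearColdBoxG`).
For every compact simple `G`, lattice representation `r` and `0 < θ ≤ 1/200`: for all large `β`, then all large odd tori and every plane `q`,
`−3β^{−5/4} ≤ E_torus[plaqCost0 q ∘ torusLift] − E_{box ⌈β^θ⌉}[c_{(centre;q)}]`. -/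
theorem torusMean_sub_boxMean_ge
    (G : Type) [Group G] [TopologicalSpace G] [IsTopologicalGroup G] [CompactSpace G] [MeasurableSpace G] [BorelSpace G]
    (hG : IsCompactSimpleLieGroup G) (r : LatticeRep G) {θ : ℝ} (hθ : 0 < θ) (hθ2 : θ ≤ 1 / 200) :
    ∃ β₀ : ℝ, ∀ β : ℝ, β₀ ≤ β → ∃ S₀ : ℕ, ∀ S : ℕ, S₀ ≤ S → ∀ q : {q : Fin 4 × Fin 4 // q.1 < q.2},
      -(3 * β ^ (-(5 / 4 : ℝ))) ≤
        (∫ U, plaqCost0 r.ρ q.1.1 q.1.2 (torusLift (2 * S + 1) U) ∂(wilsonMeasure (d := 4) (L := 2 * S + 1) r.ρ β)) -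
          (∫ W, plaqCostAt r.ρ (boxCentre ⌈β ^ θ⌉₊) q.1.1 q.1.2 W ∂(boxState r.ρ β ⌈β ^ θ⌉₊)) := by
  haveI : SecondCountableTopology G := r.secondCountableTopology
  have hρc : Continuous r.ρ := r.continuous
  have hρu : ∀ g, r.ρ g ∈ Matrix.unitaryGroup (Fin r.N) ℂ := r.mem_unitary
  have hA : (0 : ℝ) < θ / 2 := by positivity
  have hAθ : θ / 2 < θ := by linarith
  have hδ : (0 : ℝ) < θ / 5 := by positivity
  obtain ⟨K, -, βa, hlowβ⟩ := sixPlane_goodDatum_hlow G hG r hA hAθ hθ2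
  obtain ⟨βc, hrare⟩ := stub_largeFieldRarityG G r (θ / 5) hδ
  set Nr : ℝ := (r.N : ℝ) with hNr
  have hNr0 : 0 ≤ Nr := Nat.cast_nonneg _
  obtain ⟨βe, hβe⟩ := Filter.eventually_atTop.1
    (eventually_const_rpow_exp_le_rpow_div (C := 4 * Nr * (6 * 2401)) (s := 4 * θ) (b := -(5 / 4 : ℝ)) hδ one_pos)
  refine ⟨max (max βa βc) (max βe 1), fun β hβ => ?_⟩
  simp only [max_le_iff] at hβ
  obtain ⟨⟨hba, hbc⟩, hbe, hβ1⟩ := hβ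
  have hβ0 : 0 < β := by linarith
  have hH2 : (⌈β ^ θ⌉₊ : ℝ) ≤ 2 * β ^ θ := (one_le_ceil_rpow_and_le hβ1 hθ.le).2
  obtain ⟨L₀, hL₀⟩ := Filter.eventually_atTop.1 (hrare β hbc)
  refine ⟨max L₀ (2 * (2 * ⌈β ^ θ⌉₊ + 0 + 2)), fun S hS q => ?_⟩
  simp only [max_le_iff] at hS
  obtain ⟨hSL, hSbig⟩ := hS
  have hL : 2 * (2 * ⌈β ^ θ⌉₊ + 0 + 2) < 2 * S + 1 := by omega
  have hL2 := hL₀ (2 * S) (by omega)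
  haveI := isProbabilityMeasure_wilsonMeasure (d := 4) (L := 2 * S + 1) (G := G) r.ρ hρc β
  haveI : IsProbabilityMeasure (boxState r.ρ β ⌈β ^ θ⌉₊) := isProbabilityMeasure_boxKernelG r.ρ hρc β ⌈β ^ θ⌉₊ (fun _ => 1)
  haveI hKprob : ∀ U : GaugeConfig 4 (2 * S + 1) G, IsProbabilityMeasure (boxKernelG r.ρ β ⌈β ^ θ⌉₊ (torusLift (2 * S + 1) U)) :=
    fun U => isProbabilityMeasure_boxKernelG r.ρ hρc β ⌈β ^ θ⌉₊ _
  set μ := wilsonMeasure (d := 4) (L := 2 * S + 1) r.ρ β with hμ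
  have hml := measurable_torusLift (d := 4) (G := G) (2 * S + 1)
  -- the kernel mean and the flat mean
  set h : GaugeConfig 4 (2 * S + 1) G → ℝ := fun U =>
    ∫ W, plaqCostAt r.ρ (boxCentre ⌈β ^ θ⌉₊) q.1.1 q.1.2 W ∂(boxKernelG r.ρ β ⌈β ^ θ⌉₊ (torusLift (2 * S + 1) U)) with hh
  set E1 : ℝ := ∫ W, plaqCostAt r.ρ (boxCentre ⌈β ^ θ⌉₊) q.1.1 q.1.2 W ∂(boxState r.ρ β ⌈β ^ θ⌉₊) with hE1
  have hmean : ∫ U, plaqCost0 r.ρ q.1.1 q.1.2 (torusLift (2 * S + 1) U) ∂μ = ∫ U, h U ∂μ :=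
    (torusMean_eq_kernelMean_pairG (H := ⌈β ^ θ⌉₊) (T := 0) (L := 2 * S) r.ρ hρc hρu β hL q q).1
  have hcK : ∀ W, |plaqCostAt r.ρ (boxCentre ⌈β ^ θ⌉₊) q.1.1 q.1.2 W| ≤ 2 * Nr := fun W =>
    abs_plaqCostAt_leG r.ρ hρu _ q.1.1 q.1.2 W
  have hhK : ∀ U, |h U| ≤ 2 * Nr := fun U => abs_integral_ymSpecification_le r.ρ hρc β _ hcK _
  have hE1K : |E1| ≤ 2 * Nr := abs_integral_le_of_abs_le _ hcK
  have hhi : Integrable h μ :=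
    integrable_kernelMean_of_bound r.ρ hρc β ⌈β ^ θ⌉₊ S (continuous_plaqCostAtG r.ρ hρc _ q.1.1 q.1.2) hcK
  -- the bad event and its mass
  set E : Set (GaugeConfig 4 (2 * S + 1) G) := {U | torusLift (2 * S + 1) U ∈
      ⋃ z ∈ (Fintype.piFinset fun _ : Fin 4 => Finset.Icc (-1 : ℤ) (2 * (⌈β ^ θ⌉₊ : ℤ) + 1)) ×ˢ
          ((Finset.univ : Finset (Fin 4 × Fin 4)).filter fun q => q.1 < q.2),
        {W : LGConfig 4 G | β ^ (2 * (θ / 5) - 1) < plaqCostAt r.ρ z.1 z.2.1 z.2.2 W}} with hE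
  have hEm : MeasurableSet E := hml (measurableSet_badSetG r.ρ hρc β (θ / 5) ⌈β ^ θ⌉₊)
  have hgood : ∀ U, U ∉ E → CrudeGoodG r.ρ β (θ / 5) ⌈β ^ θ⌉₊ (torusLift (2 * S + 1) U) :=
    fun U hU => crudeGoodG_of_not_mem_badSet r.ρ hU
  set p : ℝ := ((6 * (2 * ⌈β ^ θ⌉₊ + 3) ^ 4 : ℕ) : ℝ) * Real.exp (-(β ^ (θ / 5))) with hp
  have hμE : μ.real E ≤ p := measureReal_badSetG_le r.ρ hρc hL2
  have hp_le : p ≤ 6 * 2401 * (β ^ (4 * θ) * Real.exp (-(β ^ (θ / 5)))) := badMass_le_rpow hβ1 hθ.le hH2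
  have hbad : 4 * Nr * μ.real E ≤ β ^ (-(5 / 4 : ℝ)) := by
    have e1 := hβe β hbe
    rw [div_one] at e1
    calc 4 * Nr * μ.real E ≤ 4 * Nr * p := mul_le_mul_of_nonneg_left hμE (by positivity)
      _ ≤ 4 * Nr * (6 * 2401 * (β ^ (4 * θ) * Real.exp (-(β ^ (θ / 5))))) := mul_le_mul_of_nonneg_left hp_le (by positivity)
      _ = 4 * Nr * (6 * 2401) * (β ^ (4 * θ) * Real.exp (-(β ^ (θ / 5)))) := by ring
      _ ≤ β ^ (-(5 / 4 : ℝ)) := e1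
  -- pointwise: good data lose at most `2β^{−5/4}`, bad data at most `4N`
  have h54 : 0 ≤ β ^ (-(5 / 4 : ℝ)) := by positivity
  have hpt : ∀ U, -(2 * β ^ (-(5 / 4 : ℝ))) - 4 * Nr * E.indicator (fun _ => (1 : ℝ)) U ≤ h U - E1 := by
    intro U
    by_cases hU : U ∈ E
    · rw [Set.indicator_of_mem hU, mul_one]
      have h1 := hhK U
      have h2 := hE1K
      rw [abs_le] at h1 h2
      linarith
    · rw [Set.indicator_of_notMem hU, mul_zero, sub_zero]
      have hn : 0 ≤ β * h U - β * E1 + 2 * β ^ (-(1 / 4 : ℝ)) := (hlowβ β hba (torusLift (2 * S + 1) U) (hgood U hU)).1 q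
      have e : β * β ^ (-(5 / 4 : ℝ)) = β ^ (-(1 / 4 : ℝ)) := by
        rw [← Real.rpow_one_add' hβ0.le (by norm_num)]; norm_num
      have h3 : β * (-(2 * β ^ (-(5 / 4 : ℝ)))) ≤ β * (h U - E1) := by
        have : β * (-(2 * β ^ (-(5 / 4 : ℝ)))) = -(2 * (β * β ^ (-(5 / 4 : ℝ)))) := by ring
        rw [this, e]
        linarith
      exact le_of_mul_le_mul_left h3 hβ0
  -- integrate
  have hindi : Integrable (fun U => E.indicator (fun _ => (1 : ℝ)) U) μ := (integrable_const 1).indicator hEm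
  have i1 : Integrable (fun U => -(2 * β ^ (-(5 / 4 : ℝ))) - 4 * Nr * E.indicator (fun _ => (1 : ℝ)) U) μ :=
    (integrable_const _).sub (hindi.const_mul _)
  have i2 : Integrable (fun U => h U - E1) μ := hhi.sub (integrable_const _)
  have hint : ∫ U, (-(2 * β ^ (-(5 / 4 : ℝ))) - 4 * Nr * E.indicator (fun _ => (1 : ℝ)) U) ∂μ ≤ ∫ U, (h U - E1) ∂μ :=
    integral_mono i1 i2 hpt
  have lhs : ∫ U, (-(2 * β ^ (-(5 / 4 : ℝ))) - 4 * Nr * E.indicator (fun _ => (1 : ℝ)) U) ∂μ =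
      -(2 * β ^ (-(5 / 4 : ℝ))) - 4 * Nr * μ.real E := by
    rw [integral_sub (integrable_const _) (hindi.const_mul _), integral_const, integral_const_mul,
      integral_indicator_const (1 : ℝ) hEm, smul_eq_mul, smul_eq_mul, probReal_univ, one_mul, mul_one]
  have rhs : ∫ U, (h U - E1) ∂μ = (∫ U, h U ∂μ) - E1 := by
    rw [integral_sub hhi (integrable_const _), integral_const, smul_eq_mul, probReal_univ, one_mul]
  have hint' : -(2 * β ^ (-(5 / 4 : ℝ))) - 4 * Nr * μ.real E ≤ (∫ U, h U ∂μ) - E1 := by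
    rw [← lhs, ← rhs]; exact hint
  rw [hmean]
  linarith [hint', hbad]

end Summit.QuantumFields.YangMills.Theorems.SixPlaneColdBox

end
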